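import Summits.NavierStokesRegularity.NavierStokesRegularity.Theorems.ExtremiserTransienceNearExtremalTransienceExtremiserLiouvilleConstantSpeedSlidePalinstrophyPointwise
import Summits.NavierStokesRegularity.NavierStokesRegularity.Theorems.ExtremiserTransienceNearExtremalTransienceExtremiserLiouvilleConstantSpeedSlidePalinstrophyBadTerm
import HarnessLib

/-!
# Crux `ExtremiserTransience.NearExtremalTransience` (stmt-NavierStokesRegularity-21883), line `extremiser_liouville`,
# stub K1b — THE PALINSTROPHY BOUND ALONG THE DISCRETE SLIDE (record §13, R3′), modulo two integrability side conditions

`--supports stmt-NavierStokesRegularity-21883` (helper).  Author: prover seat `ns-el-k1b` (g8).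
With `ψ_h = −h⁻¹φ̂_h`, `ω = curl V`, `Ψ = g(x₂)V`, `R(y) := D(curl Ψ)(y) − g(y₂)Dω(y)` (a `C^∞` field of `V, DV` and `g′, g″`, cf.
`hasFDerivAt_curl_axialWeight_smul`), `T_w(x) = (∫_{−h}^0 DK₁(x+te₂)w)e₀ − (∫_{−h}^0 DK₀(x+te₂)w)e₁`, `Kⱼ = ∂ⱼ(g′V₂)`:
* `inner_fderiv_curl_slideQuotient_smul'` : the pointwise decomposition with the UNEXPANDED remainder `R`;
* `palinstrophy_slideQuotient_le` : **`c₁(ψ_h) = ∫Σᵢ⟪∂ᵢω, D(curl ψ_h)bᵢ⟫ ≤ −½∫(D₋ₕg)|Dω|²_F − ∫Σᵢ⟪∂ᵢω, h⁻¹(R(x)−R(x−he₂))bᵢ⟫ + ∫Σᵢ⟪∂ᵢω, h⁻¹T_{bᵢ}⟫`**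
  for every `h > 0`, GIVEN the integrability of the two last integrands (hypotheses `hR`, `hT`; both hold for the residue object on
  a square-integrable layer — record §13 update 3 lists the proof; next file).  Uses only `D²V ∈ L²` (the `D³V`-looking part is
  handled by the shifted discrete product rule, …SlidePalinstrophyBadTerm).

WHAT THIS IS NOT: K1b is NOT proved; nothing here proves NS regularity. [folklore]
-/

noncomputable section

open Set Filter Topology MeasureTheory Metric Function InnerProductSpace
open scoped ENNReal NNReal Topology InnerProductSpace RealInnerProductSpace ContDiff
open Literature.Analysis.FluidPDE Literature.Analysis

namespace Summit.NavierStokesRegularity.NavierStokesRegularity.Theorems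

-- the problem directory repeats the summit name (`NavierStokesRegularity/NavierStokesRegularity`)
set_option linter.dupNamespace false

namespace ExtremiserLiouville

open DepletionLadder.KStar

variable {V : EuclideanSpace ℝ (Fin 3) → EuclideanSpace ℝ (Fin 3)} {g : ℝ → ℝ}

/-- Pointwise decomposition of the palinstrophy integrand with the unexpanded remainder `R = D(curl Ψ) − gDω`:
`⟪u, D(curl ψ_h)(x)w⟫ = −g(x₂−h)⟪u, h⁻¹(Dω(x)w − Dω(x−he₂)w)⟫ − h⁻¹(g(x₂)−g(x₂−h))⟪u, Dω(x)w⟫ − ⟪u, h⁻¹(R(x)w − R(x−he₂)w)⟫ + ⟪u, h⁻¹T_w(x)⟫`.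
[folklore] -/
theorem inner_fderiv_curl_slideQuotient_smul' (hV : ContDiff ℝ ∞ V) (hg : ContDiff ℝ ∞ g) (h : ℝ)
    (x u w : EuclideanSpace ℝ (Fin 3)) :
    ⟪u, fderiv ℝ (curl (fun x : EuclideanSpace ℝ (Fin 3) => (-h⁻¹) • (g (x 2) • V x - g ((x + (-h) • EuclideanSpace.single (2 : Fin 3) (1 : ℝ)) 2) • V (x + (-h) • EuclideanSpace.single (2 : Fin 3) (1 : ℝ)) - (∫ t in (-h)..0, deriv g ((x + t • EuclideanSpace.single (2 : Fin 3) (1 : ℝ)) 2) * V (x + t • EuclideanSpace.single (2 : Fin 3) (1 : ℝ)) 2) • EuclideanSpace.single (2 : Fin 3) (1 : ℝ)))) x w⟫ =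
      -(g (x 2 - h) * ⟪u, h⁻¹ • (fderiv ℝ (curl V) x w - fderiv ℝ (curl V) (x + (-h) • EuclideanSpace.single (2 : Fin 3) (1 : ℝ)) w)⟫) -
        h⁻¹ * (g (x 2) - g (x 2 - h)) * ⟪u, fderiv ℝ (curl V) x w⟫ -
        ⟪u, h⁻¹ • ((fderiv ℝ (curl (fun z : EuclideanSpace ℝ (Fin 3) => g (z 2) • V z)) x w - g (x 2) • fderiv ℝ (curl V) x w) -
          (fderiv ℝ (curl (fun z : EuclideanSpace ℝ (Fin 3) => g (z 2) • V z)) (x + (-h) • EuclideanSpace.single (2 : Fin 3) (1 : ℝ)) w - g (x 2 - h) • fderiv ℝ (curl V) (x + (-h) • EuclideanSpace.single (2 : Fin 3) (1 : ℝ)) w))⟫ +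
        ⟪u, h⁻¹ • ((∫ t in (-h)..0, fderiv ℝ (fun y : EuclideanSpace ℝ (Fin 3) => fderiv ℝ (fun z : EuclideanSpace ℝ (Fin 3) => deriv g (z 2) * V z 2) y (EuclideanSpace.single (1 : Fin 3) (1 : ℝ))) (x + t • EuclideanSpace.single (2 : Fin 3) (1 : ℝ)) w) • EuclideanSpace.single (0 : Fin 3) (1 : ℝ) -
            (∫ t in (-h)..0, fderiv ℝ (fun y : EuclideanSpace ℝ (Fin 3) => fderiv ℝ (fun z : EuclideanSpace ℝ (Fin 3) => deriv g (z 2) * V z 2) y (EuclideanSpace.single (0 : Fin 3) (1 : ℝ))) (x + t • EuclideanSpace.single (2 : Fin 3) (1 : ℝ)) w) • EuclideanSpace.single (1 : Fin 3) (1 : ℝ))⟫ := by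
  set e₂ : EuclideanSpace ℝ (Fin 3) := EuclideanSpace.single (2 : Fin 3) (1 : ℝ) with he₂
  have hφs : ContDiff ℝ ∞ (fun x : EuclideanSpace ℝ (Fin 3) => (g (x 2) • V x - g ((x + (-h) • e₂) 2) • V (x + (-h) • e₂) - (∫ t in (-h)..0, deriv g ((x + t • e₂) 2) * V (x + t • e₂) 2) • e₂)) :=
    contDiff_slideQuotient hV hg h
  rw [fderiv_curl_const_smul (hφs.of_le (WithTop.coe_le_coe.mpr le_top)) (-h⁻¹) x, smul_apply,
    fderiv_curl_slideQuotient_apply hV hg h x w]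
  simp only [inner_smul_right, inner_sub_right]
  ring

/-- **The palinstrophy bound along the discrete slide** (modulo the integrability of the two remainder integrands). [folklore] -/
theorem palinstrophy_slideQuotient_le (hV : ContDiff ℝ ∞ V) (hg : ContDiff ℝ ∞ g)
    (h2 : ∫⁻ x, ‖iteratedFDeriv ℝ 2 V x‖ₑ ^ 2 < ⊤) {K : ℝ} (hgK : ∀ s, |g s| ≤ K) (hg0 : ∀ s, 0 ≤ g s)
    {h : ℝ} (hh : 0 < h)
    (hR : Integrable (fun x => ∑ i : Fin 3, ⟪fderiv ℝ (curl V) x (EuclideanSpace.basisFun (Fin 3) ℝ i),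
        h⁻¹ • ((fderiv ℝ (curl (fun z : EuclideanSpace ℝ (Fin 3) => g (z 2) • V z)) x (EuclideanSpace.basisFun (Fin 3) ℝ i) - g (x 2) • fderiv ℝ (curl V) x (EuclideanSpace.basisFun (Fin 3) ℝ i)) -
          (fderiv ℝ (curl (fun z : EuclideanSpace ℝ (Fin 3) => g (z 2) • V z)) (x + (-h) • EuclideanSpace.single (2 : Fin 3) (1 : ℝ)) (EuclideanSpace.basisFun (Fin 3) ℝ i) -
            g (x 2 - h) • fderiv ℝ (curl V) (x + (-h) • EuclideanSpace.single (2 : Fin 3) (1 : ℝ)) (EuclideanSpace.basisFun (Fin 3) ℝ i)))⟫) (volume : Measure (EuclideanSpace ℝ (Fin 3))))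
    (hT : Integrable (fun x => ∑ i : Fin 3, ⟪fderiv ℝ (curl V) x (EuclideanSpace.basisFun (Fin 3) ℝ i),
        h⁻¹ • ((∫ t in (-h)..0, fderiv ℝ (fun y : EuclideanSpace ℝ (Fin 3) => fderiv ℝ (fun z : EuclideanSpace ℝ (Fin 3) => deriv g (z 2) * V z 2) y (EuclideanSpace.single (1 : Fin 3) (1 : ℝ))) (x + t • EuclideanSpace.single (2 : Fin 3) (1 : ℝ)) (EuclideanSpace.basisFun (Fin 3) ℝ i)) • EuclideanSpace.single (0 : Fin 3) (1 : ℝ) -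
            (∫ t in (-h)..0, fderiv ℝ (fun y : EuclideanSpace ℝ (Fin 3) => fderiv ℝ (fun z : EuclideanSpace ℝ (Fin 3) => deriv g (z 2) * V z 2) y (EuclideanSpace.single (0 : Fin 3) (1 : ℝ))) (x + t • EuclideanSpace.single (2 : Fin 3) (1 : ℝ)) (EuclideanSpace.basisFun (Fin 3) ℝ i)) • EuclideanSpace.single (1 : Fin 3) (1 : ℝ))⟫) (volume : Measure (EuclideanSpace ℝ (Fin 3)))) :
    ∫ x, ∑ i : Fin 3, ⟪fderiv ℝ (curl V) x (EuclideanSpace.basisFun (Fin 3) ℝ i),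
        fderiv ℝ (curl (fun x : EuclideanSpace ℝ (Fin 3) => (-h⁻¹) • (g (x 2) • V x - g ((x + (-h) • EuclideanSpace.single (2 : Fin 3) (1 : ℝ)) 2) • V (x + (-h) • EuclideanSpace.single (2 : Fin 3) (1 : ℝ)) - (∫ t in (-h)..0, deriv g ((x + t • EuclideanSpace.single (2 : Fin 3) (1 : ℝ)) 2) * V (x + t • EuclideanSpace.single (2 : Fin 3) (1 : ℝ)) 2) • EuclideanSpace.single (2 : Fin 3) (1 : ℝ)))) x (EuclideanSpace.basisFun (Fin 3) ℝ i)⟫ ≤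
      -((1 / 2) * ∫ x, (h⁻¹ * (g (x 2) - g (x 2 - h))) * frobeniusNormSq (fderiv ℝ (curl V) x)) -
        (∫ x, ∑ i : Fin 3, ⟪fderiv ℝ (curl V) x (EuclideanSpace.basisFun (Fin 3) ℝ i),
          h⁻¹ • ((fderiv ℝ (curl (fun z : EuclideanSpace ℝ (Fin 3) => g (z 2) • V z)) x (EuclideanSpace.basisFun (Fin 3) ℝ i) - g (x 2) • fderiv ℝ (curl V) x (EuclideanSpace.basisFun (Fin 3) ℝ i)) -
            (fderiv ℝ (curl (fun z : EuclideanSpace ℝ (Fin 3) => g (z 2) • V z)) (x + (-h) • EuclideanSpace.single (2 : Fin 3) (1 : ℝ)) (EuclideanSpace.basisFun (Fin 3) ℝ i) -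
              g (x 2 - h) • fderiv ℝ (curl V) (x + (-h) • EuclideanSpace.single (2 : Fin 3) (1 : ℝ)) (EuclideanSpace.basisFun (Fin 3) ℝ i)))⟫) +
        ∫ x, ∑ i : Fin 3, ⟪fderiv ℝ (curl V) x (EuclideanSpace.basisFun (Fin 3) ℝ i), h⁻¹ • ((∫ t in (-h)..0, fderiv ℝ (fun y : EuclideanSpace ℝ (Fin 3) => fderiv ℝ (fun z : EuclideanSpace ℝ (Fin 3) => deriv g (z 2) * V z 2) y (EuclideanSpace.single (1 : Fin 3) (1 : ℝ))) (x + t • EuclideanSpace.single (2 : Fin 3) (1 : ℝ)) (EuclideanSpace.basisFun (Fin 3) ℝ i)) • EuclideanSpace.single (0 : Fin 3) (1 : ℝ) -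
            (∫ t in (-h)..0, fderiv ℝ (fun y : EuclideanSpace ℝ (Fin 3) => fderiv ℝ (fun z : EuclideanSpace ℝ (Fin 3) => deriv g (z 2) * V z 2) y (EuclideanSpace.single (0 : Fin 3) (1 : ℝ))) (x + t • EuclideanSpace.single (2 : Fin 3) (1 : ℝ)) (EuclideanSpace.basisFun (Fin 3) ℝ i)) • EuclideanSpace.single (1 : Fin 3) (1 : ℝ))⟫ := by
  set e₂ : EuclideanSpace ℝ (Fin 3) := EuclideanSpace.single (2 : Fin 3) (1 : ℝ) with he₂
  set b := EuclideanSpace.basisFun (Fin 3) ℝ with hb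
  have hgc : Continuous g := hg.continuous
  have hV3 : ContDiff ℝ 3 V := hV.of_le (WithTop.coe_le_coe.mpr le_top)
  have hω1 : ContDiff ℝ 1 (curl V) := contDiff_curl (n := 1) (hV.of_le (WithTop.coe_le_coe.mpr le_top))
  have cDω : Continuous (fderiv ℝ (curl V)) := hω1.continuous_fderiv one_ne_zero
  have iF : Integrable (fun x => frobeniusNormSq (fderiv ℝ (curl V) x)) (volume : Measure (EuclideanSpace ℝ (Fin 3))) :=
    (integrable_frobeniusNormSq_fderiv_curl hV3 h2).1
  have hcomp : ∀ i : Fin 3, Integrable (fun x => ‖fderiv ℝ (curl V) x (b i)‖ ^ 2) (volume : Measure (EuclideanSpace ℝ (Fin 3))) := by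
    intro i
    refine iF.mono' ((cDω.clm_apply continuous_const).norm.pow 2).aestronglyMeasurable (Eventually.of_forall fun x => ?_)
    rw [Real.norm_eq_abs, abs_of_nonneg (sq_nonneg _), frobeniusNormSq_eq_sum b]
    exact Finset.single_le_sum (f := fun j => ‖fderiv ℝ (curl V) x (b j)‖ ^ 2) (fun j _ => sq_nonneg _) (Finset.mem_univ i)
  -- (t1ᵢ): the bad terms are integrable
  have hK2 : ∀ s, |g (s - h)| ≤ K := fun s => hgK _
  have it1 : ∀ i : Fin 3, Integrable (fun x => g (x 2 - h) * ⟪fderiv ℝ (curl V) x (b i),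
      h⁻¹ • (fderiv ℝ (curl V) x (b i) - fderiv ℝ (curl V) (x + (-h) • e₂) (b i))⟫)
      (volume : Measure (EuclideanSpace ℝ (Fin 3))) := by
    intro i
    have cF : Continuous fun x => fderiv ℝ (curl V) x (b i) := cDω.clm_apply continuous_const
    have cFa : Continuous fun x => fderiv ℝ (curl V) (x + (-h) • e₂) (b i) := cF.comp (continuous_id.add continuous_const)
    have iFa : Integrable (fun x => ‖fderiv ℝ (curl V) (x + (-h) • e₂) (b i)‖ ^ 2) (volume : Measure (EuclideanSpace ℝ (Fin 3))) :=
      (hcomp i).comp_add_right ((-h) • e₂)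
    have cw : Continuous fun x : EuclideanSpace ℝ (Fin 3) => g (x 2 - h) :=
      hgc.comp ((PiLp.continuous_apply 2 _ (2 : Fin 3)).sub continuous_const)
    refine ((((hcomp i).const_mul (3 / 2)).add (iFa.const_mul (1 / 2))).const_mul (K * h⁻¹)).mono'
      ((cw.mul (cF.inner ((cF.sub cFa).const_smul h⁻¹))).aestronglyMeasurable) (Eventually.of_forall fun x => ?_)
    rw [Real.norm_eq_abs, abs_mul, inner_smul_right, abs_mul, abs_of_pos (inv_pos.2 hh)]
    have hin : |⟪fderiv ℝ (curl V) x (b i), fderiv ℝ (curl V) x (b i) - fderiv ℝ (curl V) (x + (-h) • e₂) (b i)⟫| ≤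
        (3 / 2) * ‖fderiv ℝ (curl V) x (b i)‖ ^ 2 + (1 / 2) * ‖fderiv ℝ (curl V) (x + (-h) • e₂) (b i)‖ ^ 2 := by
      have h1 := abs_real_inner_le_norm (fderiv ℝ (curl V) x (b i)) (fderiv ℝ (curl V) x (b i) - fderiv ℝ (curl V) (x + (-h) • e₂) (b i))
      have h2 := norm_sub_le (fderiv ℝ (curl V) x (b i)) (fderiv ℝ (curl V) (x + (-h) • e₂) (b i))
      nlinarith [norm_nonneg (fderiv ℝ (curl V) x (b i)), norm_nonneg (fderiv ℝ (curl V) (x + (-h) • e₂) (b i)),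
        norm_nonneg (fderiv ℝ (curl V) x (b i) - fderiv ℝ (curl V) (x + (-h) • e₂) (b i)),
        sq_nonneg (‖fderiv ℝ (curl V) x (b i)‖ - ‖fderiv ℝ (curl V) (x + (-h) • e₂) (b i)‖)]
    have hK0 : 0 ≤ K := (abs_nonneg _).trans (hgK 0)
    simp only [Pi.add_apply]
    calc |g (x 2 - h)| * (h⁻¹ * |⟪fderiv ℝ (curl V) x (b i), fderiv ℝ (curl V) x (b i) - fderiv ℝ (curl V) (x + (-h) • e₂) (b i)⟫|)
        ≤ K * (h⁻¹ * ((3 / 2) * ‖fderiv ℝ (curl V) x (b i)‖ ^ 2 + (1 / 2) * ‖fderiv ℝ (curl V) (x + (-h) • e₂) (b i)‖ ^ 2)) :=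
          mul_le_mul (hK2 _) (mul_le_mul_of_nonneg_left hin (inv_nonneg.2 hh.le)) (by positivity) hK0
      _ = K * h⁻¹ * ((3 / 2) * ‖fderiv ℝ (curl V) x (b i)‖ ^ 2 + (1 / 2) * ‖fderiv ℝ (curl V) (x + (-h) • e₂) (b i)‖ ^ 2) := by ring
  -- (t2): the weight term is integrable
  have hq : ∀ s, |h⁻¹ * (g s - g (s - h))| ≤ h⁻¹ * (K + K) := fun s => by
    rw [abs_mul, abs_of_pos (inv_pos.2 hh)]
    exact mul_le_mul_of_nonneg_left ((abs_sub _ _).trans (add_le_add (hgK _) (hgK _))) (inv_nonneg.2 hh.le)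
  have cwq : Continuous fun x : EuclideanSpace ℝ (Fin 3) => h⁻¹ * (g (x 2) - g (x 2 - h)) :=
    continuous_const.mul ((hgc.comp (PiLp.continuous_apply 2 _ (2 : Fin 3))).sub
      (hgc.comp ((PiLp.continuous_apply 2 _ (2 : Fin 3)).sub continuous_const)))
  have it2 : ∀ i : Fin 3, Integrable (fun x => (h⁻¹ * (g (x 2) - g (x 2 - h))) * ‖fderiv ℝ (curl V) x (b i)‖ ^ 2)
      (volume : Measure (EuclideanSpace ℝ (Fin 3))) := by
    intro i
    refine ((hcomp i).const_mul (h⁻¹ * (K + K))).mono' (cwq.aestronglyMeasurable.mul (hcomp i).1)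
      (Eventually.of_forall fun x => ?_)
    rw [Real.norm_eq_abs, abs_mul, abs_of_nonneg (sq_nonneg ‖fderiv ℝ (curl V) x (b i)‖)]
    exact mul_le_mul_of_nonneg_right (hq _) (sq_nonneg _)
  -- rewrite the integrand pointwise and split
  have hpt : ∀ x, ∑ i : Fin 3, ⟪fderiv ℝ (curl V) x (b i),
      fderiv ℝ (curl (fun x : EuclideanSpace ℝ (Fin 3) => (-h⁻¹) • (g (x 2) • V x - g ((x + (-h) • e₂) 2) • V (x + (-h) • e₂) - (∫ t in (-h)..0, deriv g ((x + t • e₂) 2) * V (x + t • e₂) 2) • e₂))) x (b i)⟫ =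
      (∑ i : Fin 3, -(g (x 2 - h) * ⟪fderiv ℝ (curl V) x (b i),
        h⁻¹ • (fderiv ℝ (curl V) x (b i) - fderiv ℝ (curl V) (x + (-h) • e₂) (b i))⟫)) -
      (∑ i : Fin 3, (h⁻¹ * (g (x 2) - g (x 2 - h))) * ‖fderiv ℝ (curl V) x (b i)‖ ^ 2) -
      (∑ i : Fin 3, ⟪fderiv ℝ (curl V) x (b i),
        h⁻¹ • ((fderiv ℝ (curl (fun z : EuclideanSpace ℝ (Fin 3) => g (z 2) • V z)) x (b i) - g (x 2) • fderiv ℝ (curl V) x (b i)) -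
          (fderiv ℝ (curl (fun z : EuclideanSpace ℝ (Fin 3) => g (z 2) • V z)) (x + (-h) • e₂) (b i) -
            g (x 2 - h) • fderiv ℝ (curl V) (x + (-h) • e₂) (b i)))⟫) +
      ∑ i : Fin 3, ⟪fderiv ℝ (curl V) x (b i), h⁻¹ • ((∫ t in (-h)..0, fderiv ℝ (fun y : EuclideanSpace ℝ (Fin 3) => fderiv ℝ (fun z : EuclideanSpace ℝ (Fin 3) => deriv g (z 2) * V z 2) y (EuclideanSpace.single (1 : Fin 3) (1 : ℝ))) (x + t • e₂) (b i)) • EuclideanSpace.single (0 : Fin 3) (1 : ℝ) -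
            (∫ t in (-h)..0, fderiv ℝ (fun y : EuclideanSpace ℝ (Fin 3) => fderiv ℝ (fun z : EuclideanSpace ℝ (Fin 3) => deriv g (z 2) * V z 2) y (EuclideanSpace.single (0 : Fin 3) (1 : ℝ))) (x + t • e₂) (b i)) • EuclideanSpace.single (1 : Fin 3) (1 : ℝ))⟫ := by
    intro x
    rw [← Finset.sum_sub_distrib, ← Finset.sum_sub_distrib, ← Finset.sum_add_distrib]
    refine Finset.sum_congr rfl fun i _ => ?_
    rw [inner_fderiv_curl_slideQuotient_smul' hV hg h x (fderiv ℝ (curl V) x (b i)) (b i), real_inner_self_eq_norm_sq]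
  have it1n : ∀ i : Fin 3, Integrable (fun x => -(g (x 2 - h) * ⟪fderiv ℝ (curl V) x (b i),
      h⁻¹ • (fderiv ℝ (curl V) x (b i) - fderiv ℝ (curl V) (x + (-h) • e₂) (b i))⟫))
      (volume : Measure (EuclideanSpace ℝ (Fin 3))) := fun i => (it1 i).neg
  have i1 : Integrable (fun x => ∑ i : Fin 3, -(g (x 2 - h) * ⟪fderiv ℝ (curl V) x (b i),
      h⁻¹ • (fderiv ℝ (curl V) x (b i) - fderiv ℝ (curl V) (x + (-h) • e₂) (b i))⟫))
      (volume : Measure (EuclideanSpace ℝ (Fin 3))) := integrable_finsetSum _ fun i _ => it1n i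
  have i2 : Integrable (fun x => ∑ i : Fin 3, (h⁻¹ * (g (x 2) - g (x 2 - h))) * ‖fderiv ℝ (curl V) x (b i)‖ ^ 2)
      (volume : Measure (EuclideanSpace ℝ (Fin 3))) := integrable_finsetSum _ fun i _ => it2 i
  have i12 : Integrable (fun x => (∑ i : Fin 3, -(g (x 2 - h) * ⟪fderiv ℝ (curl V) x (b i),
        h⁻¹ • (fderiv ℝ (curl V) x (b i) - fderiv ℝ (curl V) (x + (-h) • e₂) (b i))⟫)) -
      (∑ i : Fin 3, (h⁻¹ * (g (x 2) - g (x 2 - h))) * ‖fderiv ℝ (curl V) x (b i)‖ ^ 2)) (volume : Measure (EuclideanSpace ℝ (Fin 3))) := i1.sub i2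
  have i123 : Integrable (fun x => (∑ i : Fin 3, -(g (x 2 - h) * ⟪fderiv ℝ (curl V) x (b i),
        h⁻¹ • (fderiv ℝ (curl V) x (b i) - fderiv ℝ (curl V) (x + (-h) • e₂) (b i))⟫)) -
      (∑ i : Fin 3, (h⁻¹ * (g (x 2) - g (x 2 - h))) * ‖fderiv ℝ (curl V) x (b i)‖ ^ 2) -
      (∑ i : Fin 3, ⟪fderiv ℝ (curl V) x (b i),
        h⁻¹ • ((fderiv ℝ (curl (fun z : EuclideanSpace ℝ (Fin 3) => g (z 2) • V z)) x (b i) - g (x 2) • fderiv ℝ (curl V) x (b i)) -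
          (fderiv ℝ (curl (fun z : EuclideanSpace ℝ (Fin 3) => g (z 2) • V z)) (x + (-h) • e₂) (b i) -
            g (x 2 - h) • fderiv ℝ (curl V) (x + (-h) • e₂) (b i)))⟫)) (volume : Measure (EuclideanSpace ℝ (Fin 3))) := i12.sub hR
  rw [integral_congr_ae (Eventually.of_forall hpt), integral_add i123 hT, integral_sub i12 hR,
    integral_sub i1 i2, integral_finsetSum _ fun i _ => it1n i]
  simp only [integral_neg]
  -- the bad terms
  have hbad := sum_neg_integral_shiftedWeight_inner_backwardQuotient_le hV h2 hgc hgK hg0 hh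
  have hbad' : ∑ i : Fin 3, -(∫ x, g (x 2 - h) * ⟪fderiv ℝ (curl V) x (b i),
      h⁻¹ • (fderiv ℝ (curl V) x (b i) - fderiv ℝ (curl V) (x + (-h) • e₂) (b i))⟫) ≤
      (1 / 2) * ∫ x, (h⁻¹ * (g (x 2) - g (x 2 - h))) * frobeniusNormSq (fderiv ℝ (curl V) x) := by
    have e : ∀ x : EuclideanSpace ℝ (Fin 3), x - h • EuclideanSpace.single (2 : Fin 3) (1 : ℝ) =
        x + (-h) • EuclideanSpace.single (2 : Fin 3) (1 : ℝ) := fun x => by rw [sub_eq_add_neg, neg_smul]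
    simp only [e] at hbad
    exact hbad
  -- the weight term: `Σᵢ ∫ w‖∂ᵢω‖² = ∫ w |Dω|²_F`
  have hw : (∫ x, ∑ i : Fin 3, (h⁻¹ * (g (x 2) - g (x 2 - h))) * ‖fderiv ℝ (curl V) x (b i)‖ ^ 2) =
      ∫ x, (h⁻¹ * (g (x 2) - g (x 2 - h))) * frobeniusNormSq (fderiv ℝ (curl V) x) := by
    refine integral_congr_ae (Eventually.of_forall fun x => ?_)
    show ∑ i : Fin 3, (h⁻¹ * (g (x 2) - g (x 2 - h))) * ‖fderiv ℝ (curl V) x (b i)‖ ^ 2 =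
      (h⁻¹ * (g (x 2) - g (x 2 - h))) * frobeniusNormSq (fderiv ℝ (curl V) x)
    rw [← Finset.mul_sum, frobeniusNormSq_eq_sum b]
  rw [hw]
  linarith

end ExtremiserLiouville

end Summit.NavierStokesRegularity.NavierStokesRegularity.Theorems

end
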